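import Summits.QuantumFields.YangMills.Theorems.UnitScaleTiltProp7LandauCombDict
import Summits.QuantumFields.YangMills.Theorems.UnitScaleTiltProp7CombPeriodCellDict
import Summits.QuantumFields.YangMills.Theorems.UnitScaleTiltProp7CovIterLambdaHLambdaBridge
import HarnessLib

/-!
# Route `UnitScaleTilt`, crux K1 «MinimiserStabilityRegPr» (stmt-QuantumFields-19200), route-R E′ (A′)-on-Σ, P-A2 (β), row «(n3)-comb» —
# (O2) GROUNDWORK, file F-8c-1: THE PULLBACK DICTIONARY FOR THE LEVEL-0 COVARIANT GRADIENT AND MASS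
# («the ℤ³ period-cell sums of the based pullbacks ARE the torus sums of SIGNATURE-0's member letters: covariant gradient ↦ the Weitzenböck row's left side, mass ↦ `Σ_b ‖Y b‖²`»)

«(O2) groundwork — not consumed by any displayed row before the freeze lifts» (★★OWNER `ym3-torus-plan` g29∕g30 RULINGS №20 (2), №22; «(II) GO» 06:26∕06:31Z;
SPEC F-8 «TOP KNIT» `ym-routeR-w1/SPEC-F8-TOPKNIT-routeRw1g9.md` §3).  Cell `ym3-torus`, D-0154 (3c) R3 twin-width seat `ym-routeR-w1` (gen 9).  THEOREMS ONLY
(0 `def`, 0 `sorry`); `--supports stmt-QuantumFields-19200 --as helper`, count-neutral.  YM₃ on T³ is a ladder rung (R3), not the Clay problem; nothing here claims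
`hMcomb`, `hMcomb₂`, (β), `hPA2`, `hcoS`, the stub, the crux, d = 4 or the mass gap.

THE POINT.  The (II) lane is typed on `ℤᵈ` (W1): backgrounds `pull (bgUnits F K W) y`, fields `pull Y y` for a torus bond function `Y : PBond (F.P K) 0 → M₂(ℂ)`, every `ℓ²`
quantity a sum over ONE period cell `{boxVec N₀ t}` (`N₀ = sitesPerDir 0`).  The member adapter F-8c (target = G3 ✓`hD_of_hMcomb_of_rem2Rows`'s hypothesis `hMc`) must read
the lane's two level-0 currencies back on the torus: the COVARIANT GRADIENT `Σ_{cell}Σ_{μ,ν}‖Ad_{V♯(z,ν)}Y♯(z+e_ν, μ) − Y♯(z, μ)‖²` (✓F-6a-2∕✓F-6c-2b's `GRAD^{cov}` letter) and the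
MASS `Σ_{cell}Σ_μ‖Y♯(z,μ)‖²`.  This file shows they are EXACTLY the torus sums: the first is the left side of the Weitzenböck row ✓`Prop7CovIterLambdaHLambdaBridge.
sum_normSq_covGrad_le_curl_divB` (`Σ_b Σ_ν ‖W(b.src,ν)·Y(b.src+e_ν, b.dir)·W(b.src,ν)* − Y b‖²`), the second `Σ_b ‖Y b‖²`.
* §1 `conjR_pull_bgUnits` (`Ad` of the pulled-back background bond = `W(·)·(·)·W(·)*` at the translated site — `rfl`-class), `covGrad_pull_eq` (one covariant difference, with
  lit ✓`transl_add_e`), `normSq_pull_eq`.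
* §2 ★ `sum_cell_transl_eq_sum_site` — a period-cell sum of `z ↦ f (transl y z)` is the torus site sum (✓`Prop7LandauCombDict.sum_univ_eq_sum_box_transl` + ✓F-8a `sum_box_eq_sum_boxVec`),
  ★★ `sum_cell_normSq_covGrad_pull_eq` and ★★ `sum_cell_normSq_pull_eq` — the two currencies, as sums over `t : Fin d → Fin N₀` with `hN : (F.P K).sitesPerDir 0 = N₀` (F-8a's socket shape).
* §3 ★★ `sum_cell_normSq_covGrad_pull_le_curl_divB` — the Weitzenböck row READ ON THE CELL: `GRADcell ≤ (CURL_W(Y) + DIV_W(Y)) + 2·d·a·(2·Σ_b‖Y b‖²)` under `dist1(W(∂p)) ≤ a`.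
HONEST SCOPE.  Re-indexing over cited rows; F-8b (the cell theorem) and the rest of F-8c (windows, currency of `Y₀ = e^{iX} − 1` vs `iX`, the final `obtain`) are separate files.

References: T. Bałaban, CMP **99** (1985) 75–102 [Balaban1985RegularSpaces] ((1.1)–(1.3) pp.76–77); CMP **109** (1987) 249–301 [Balaban1987RG1] ((0.1) p.251);
CMP **98** (1985) 17–51 [Balaban1985Averaging] ((19) p.21).
-/

set_option autoImplicit false

noncomputable section

open scoped BigOperators Matrix.Norms.L2Operator

namespace Summit.QuantumFields.YangMills.Theorems.Prop7CombPullbackGradDict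

open Literature.MathematicalPhysics.QuantumFieldTheory.Balaban1983to89
open Literature.MathematicalPhysics.QuantumFieldTheory.Balaban1983to89.T3ContinuumYM3Torus
open B7Prop1Explicit renaming Site → LSite
open B7Prop1Explicit (e boxVec)
open B7Eq78Linearization (conjR conjR_apply)
open B10Eq27TorusAxialLog (transl transl_add_e pull pull_apply unitsField toUField)
open T4TermwiseTorus (box)
open T3SectALandauChart (bgUnits)
open B9Eq39Adjoint (curl divB)
open B10StarCount (sum_pbond)
open Summit.QuantumFields.YangMills.Theorems.Prop7LandauCombDict (sum_univ_eq_sum_box_transl)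
open Summit.QuantumFields.YangMills.Theorems.Prop7CombPeriodCellDict (sum_box_eq_sum_boxVec)
open B9TorusCalculus (torusT)
open Summit.QuantumFields.YangMills.Theorems.Prop7CovIterLambdaHLambdaBridge (sum_normSq_covGrad_le_curl_divB)

variable (F : T3Family) (K : ℕ)

/-! ## §1 Pointwise dictionary -/

/-- `Ad` of a pulled-back background bond is `W·(·)·W*` at the translated bond (`SU(2)` inverse = conjugate transpose; all coercions `rfl`). [cite: Balaban1985Averaging, (19) p.21] -/
theorem conjR_pull_bgUnits (W : GaugeField (F.P K) 0 (Matrix.specialUnitaryGroup (Fin 2) ℂ)) (y : Site (F.P K) 0) (z : LSite (F.P K).d) (ν : Fin (F.P K).d)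
    (M : Matrix (Fin 2) (Fin 2) ℂ) :
    conjR (pull (bgUnits F K W) y z ν) M
      = ((W ⟨transl y z, ν⟩ : Matrix.specialUnitaryGroup (Fin 2) ℂ) : Matrix (Fin 2) (Fin 2) ℂ) * M
          * star ((W ⟨transl y z, ν⟩ : Matrix.specialUnitaryGroup (Fin 2) ℂ) : Matrix (Fin 2) (Fin 2) ℂ) := rfl

/-- ONE COVARIANT DIFFERENCE of the pulled-back field along the pulled-back background is the torus covariant difference at the translated bond (lit ✓`transl_add_e`).
[cite: Balaban1985RegularSpaces, (1.1)–(1.2) p.76] -/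
theorem covGrad_pull_eq (W : GaugeField (F.P K) 0 (Matrix.specialUnitaryGroup (Fin 2) ℂ)) (Y : PBond (F.P K) 0 → Matrix (Fin 2) (Fin 2) ℂ)
    (y : Site (F.P K) 0) (z : LSite (F.P K).d) (μ ν : Fin (F.P K).d) :
    conjR (pull (bgUnits F K W) y z ν) (pull Y y (z + e ν) μ) - pull Y y z μ
      = ((W ⟨transl y z, ν⟩ : Matrix.specialUnitaryGroup (Fin 2) ℂ) : Matrix (Fin 2) (Fin 2) ℂ) * Y ⟨(transl y z).shift ν, μ⟩
          * star ((W ⟨transl y z, ν⟩ : Matrix.specialUnitaryGroup (Fin 2) ℂ) : Matrix (Fin 2) (Fin 2) ℂ) - Y ⟨transl y z, μ⟩ := by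
  rw [conjR_pull_bgUnits, pull_apply, pull_apply, transl_add_e]

/-- The pulled-back field's bond value is the torus bond value at the translated bond. [cite: Balaban1985RegularSpaces, (1.3) p.77] -/
theorem normSq_pull_eq (Y : PBond (F.P K) 0 → Matrix (Fin 2) (Fin 2) ℂ) (y : Site (F.P K) 0) (z : LSite (F.P K).d) (μ : Fin (F.P K).d) :
    ‖pull Y y z μ‖ ^ 2 = ‖Y ⟨transl y z, μ⟩‖ ^ 2 := by
  rw [pull_apply]

/-! ## §2 Period-cell sums are torus sums -/

/-- ★ **A PERIOD-CELL SUM OF A TRANSLATED TORUS FUNCTION IS THE TORUS SUM**: `Σ_{t : Fin d → Fin N₀} f (y + boxVec t) = Σ_{x : T⁰} f x` (`N₀ = sitesPerDir 0`; any base `y`).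
[cite: Balaban1985RegularSpaces, p.77 («Ω_j = T_η»)] -/
theorem sum_cell_transl_eq_sum_site {M : Type*} [AddCommMonoid M] {j N : ℕ} (hN : (F.P K).sitesPerDir j = N) (y : Site (F.P K) j) (f : Site (F.P K) j → M) :
    ∑ t : Fin (F.P K).d → Fin N, f (transl y (boxVec N t)) = ∑ x : Site (F.P K) j, f x := by
  subst hN
  rw [sum_univ_eq_sum_box_transl y f, sum_box_eq_sum_boxVec]

/-- ★★ **THE COVARIANT-GRADIENT CURRENCY**: the period-cell sum of the squared covariant differences of the pulled-back field along the pulled-back background equals the torus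
sum of the Weitzenböck row's left side. [cite: Balaban1985RegularSpaces, (1.1)–(1.3) pp.76–77] -/
theorem sum_cell_normSq_covGrad_pull_eq {N : ℕ} (hN : (F.P K).sitesPerDir 0 = N) (W : GaugeField (F.P K) 0 (Matrix.specialUnitaryGroup (Fin 2) ℂ))
    (Y : PBond (F.P K) 0 → Matrix (Fin 2) (Fin 2) ℂ) (y : Site (F.P K) 0) :
    ∑ t : Fin (F.P K).d → Fin N, ∑ μ : Fin (F.P K).d, ∑ ν : Fin (F.P K).d,
        ‖conjR (pull (bgUnits F K W) y (boxVec N t) ν) (pull Y y (boxVec N t + e ν) μ) - pull Y y (boxVec N t) μ‖ ^ 2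
      = ∑ b : PBond (F.P K) 0, ∑ ν : Fin (F.P K).d,
        ‖((W ⟨b.src, ν⟩ : Matrix.specialUnitaryGroup (Fin 2) ℂ) : Matrix (Fin 2) (Fin 2) ℂ) * Y ⟨b.src.shift ν, b.dir⟩
            * star ((W ⟨b.src, ν⟩ : Matrix.specialUnitaryGroup (Fin 2) ℂ) : Matrix (Fin 2) (Fin 2) ℂ) - Y b‖ ^ 2 := by
  simp only [covGrad_pull_eq]
  rw [sum_cell_transl_eq_sum_site F K hN y (fun x => ∑ μ : Fin (F.P K).d, ∑ ν : Fin (F.P K).d,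
    ‖((W ⟨x, ν⟩ : Matrix.specialUnitaryGroup (Fin 2) ℂ) : Matrix (Fin 2) (Fin 2) ℂ) * Y ⟨x.shift ν, μ⟩
        * star ((W ⟨x, ν⟩ : Matrix.specialUnitaryGroup (Fin 2) ℂ) : Matrix (Fin 2) (Fin 2) ℂ) - Y ⟨x, μ⟩‖ ^ 2), sum_pbond]

/-- ★★ **THE MASS CURRENCY**: the period-cell sum of the pulled-back field's squared norms is `Σ_b ‖Y b‖²`. [cite: Balaban1985RegularSpaces, (1.3) p.77] -/
theorem sum_cell_normSq_pull_eq {N : ℕ} (hN : (F.P K).sitesPerDir 0 = N) (Y : PBond (F.P K) 0 → Matrix (Fin 2) (Fin 2) ℂ) (y : Site (F.P K) 0) :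
    ∑ t : Fin (F.P K).d → Fin N, ∑ μ : Fin (F.P K).d, ‖pull Y y (boxVec N t) μ‖ ^ 2 = ∑ b : PBond (F.P K) 0, ‖Y b‖ ^ 2 := by
  simp only [normSq_pull_eq]
  rw [sum_cell_transl_eq_sum_site F K hN y (fun x => ∑ μ : Fin (F.P K).d, ‖Y ⟨x, μ⟩‖ ^ 2), sum_pbond]

/-! ## §3 The Weitzenböck row read on the cell -/

/-- ★★ **THE WEITZENBÖCK ROW ON THE PERIOD CELL**: under the plaquette bound `dist1(W(∂p)) ≤ a` (RegPr at the member), the cell covariant-gradient currency of the pulled-back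
field is at most `CURL_W(Y) + DIV_W(Y) + 2·d·a·(2·Σ_b‖Y b‖²)` — ✓`sum_normSq_covGrad_le_curl_divB` composed with §2, in the EXACT `curl`∕`divB` letters of G3's `hMc`.
[cite: Balaban1985RegularSpaces, (1.1)–(1.3) pp.76–77] -/
theorem sum_cell_normSq_covGrad_pull_le_curl_divB {N : ℕ} (hN : (F.P K).sitesPerDir 0 = N) (W : GaugeField (F.P K) 0 (Matrix.specialUnitaryGroup (Fin 2) ℂ))
    {a : ℝ} (ha : 0 ≤ a) (hW : ∀ p : Plaq (F.P K) 0, dist1 (GaugeField.plaqHol W p) ≤ a)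
    (Y : PBond (F.P K) 0 → Matrix (Fin 2) (Fin 2) ℂ) (y : Site (F.P K) 0) :
    ∑ t : Fin (F.P K).d → Fin N, ∑ μ : Fin (F.P K).d, ∑ ν : Fin (F.P K).d,
        ‖conjR (pull (bgUnits F K W) y (boxVec N t) ν) (pull Y y (boxVec N t + e ν) μ) - pull Y y (boxVec N t) μ‖ ^ 2
      ≤ (∑ x : Site (F.P K) 0, ∑ μ : Fin (F.P K).d, ∑ ν : Fin (F.P K).d,
            (if μ < ν then ∑ j : Fin 2, ∑ k : Fin 2,
              ‖(curl (torusT (F.P K) 0) (fun κ z => unitsField (toUField W) ⟨z, κ⟩) (fun κ z => Y ⟨z, κ⟩) μ ν x) j k‖ ^ 2 else 0)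
          + ∑ x : Site (F.P K) 0, ∑ j : Fin 2, ∑ k : Fin 2,
              ‖(divB (torusT (F.P K) 0) (fun κ z => unitsField (toUField W) ⟨z, κ⟩) (fun κ z => Y ⟨z, κ⟩) x) j k‖ ^ 2)
        + 2 * (F.P K).d * a * (2 * ∑ b : PBond (F.P K) 0, ‖Y b‖ ^ 2) := by
  rw [sum_cell_normSq_covGrad_pull_eq F K hN W Y y]
  have h := sum_normSq_covGrad_le_curl_divB W ha hW Y
  simpa using h

end Summit.QuantumFields.YangMills.Theorems.Prop7CombPullbackGradDict
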